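import Summits.QuantumFields.BalabanUV.Gaps.D1WardTraceForm
import Summits.QuantumFields.BalabanUV.Gaps.D1ReynoldsMeanDrift
import Summits.QuantumFields.BalabanUV.Gaps.D1WordwiseDrift
import Summits.QuantumFields.BalabanUV.Beta.D1BFx.RoadEnd

/-!
# `BalabanUV.Gaps.D1WardDriftTests` — cell pub-balaban-gaps, row (D1), seat g1-p1: PIN-FREE BY-VALUE TESTS OF (D1) UNDER THE WARD BINDER (Cesàro means of ONE diagonal longitudinal
# moment ∕ of the trace scalar) AND THE CHANNEL BUDGET (under hW alone the trace drift law REPLACES any one of the six channels)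

HONEST FRAMING (cell rule, page 1 of everything): [folklore] composition BY NAME — row 86 of this seat (`D1WardLongitudinalForm.secondMoment_TbalOf_…_eq_neg_half_of_hW`), row 88
(`D1WardTraceForm.twelve_mul_secondMoment_reynoldsMean_…_eq_trace_of_hW`), GEN 14 (`D1ReynoldsMeanDrift.d1Drift_six_to_reynoldsMean_…`, `sum_ite_lt_eq_sum_offDiagPairsLT`,
`D1ReynoldsMeanPairs.six_mul_secondMoment_reynoldsMean_…`), GEN 4's drift calculus (`D1WordwiseDrift.oneLoopDrift_sub ∕ _sum`), road BF-x's `D1BFx.RoadEnd.tendsto_cesaro_of_oneLoopDrift`,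
an2∕an4's `OneStepKernelFamily.D1Drift ∕ secondMoment_flipK`; row 89 (`D1WardLongitudinalDrift`, p402612 ✓) is the reading these tests serve (its two drift laws are re-derived inline here,
not imported, so that this file elaborates against built modules only).  The Ward binder `hW` (5.9) [Balaban1987RG1 p. 293] REMAINS A HYPOTHESIS on
members of the cells' OWN literals; nothing of Bałaban's asserted beyond print; NO coefficient computed or signed; (D1) NOT discharged; 0∕4 row-D1 binders at the pinned ∕ (III′) literals;
NOT `BetaPertH`, NOT continuum, NOT Clay.
HONEST DEPENDENCY (b2b cell, verbatim): «continuum YM on T⁴ ⇐ BetaPertH ∧ nine spine estimates (0/9 proved); BetaPertH ⇐ (D1) ∧ (D4) ∧ CAP+tail; G-an2-4 gates asym, D1 and NE2/3/4.»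

WHY (census row 90 of `HOME/g1/RESIDUE.md`).  Row 89 read (D1) in its own `OneLoopDrift` currency, pin-free, on ONE diagonal longitudinal moment and (six channels) on the trace scalar.  Two
consequences a by-value desk can USE at any `cE₂`, with no rate certificate and no limit object: (T) NECESSARY TESTS — under `∀ j, hW_j`, (D1) at `(μ,ν)` forces the Cesàro means
`(1∕m) Σ_{j<m} Σ_z T_j(ν,ν,z) z_μ² → −2·stepBal N Lc`, and (D1) at the six channels forces `(1∕m) Σ_{j<m} Σ_ν Σ_z T_j(ν,ν,z)|z|² → −24·stepBal N Lc` (a drift law gives its Cesàro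
limit outright, `|mean − slope| ≤ A∕m`); (B) THE CHANNEL BUDGET — at every level `Σ_{a<b} β⁰_j(a,b) = −¼ Σ_ν Σ_z T_j(ν,ν,z)|z|²` under `hW_j` ALONE (no (1.21)), so the trace drift law and
(D1) at any FIVE channels give (D1) at the sixth: under `∀ j, hW_j`, «(D1) at six channels» ⟺ «(D1) at five channels ∧ the trace drift law» — the axis-order-blind scalar (immune to the
axial gauge's (1.21) defect, row 85h) can stand in for any one channel.
WHAT IT IS NOT: nothing is discharged; the words of the row do not move.

CONTENT (all [folklore]; no `def`, 0 sorry): §0 drift calculus addenda `oneLoopDrift_const_mul`, `oneLoopDrift_congr`, `exists_oneLoopDrift_sum`; §1 pinned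
family (any `1 ≤ Lc`, root, colours, `cE₂`, `cB`, `T`): **`tendsto_cesaro_longitudinal_of_d1Drift_of_hW`**, **`tendsto_cesaro_trace_of_d1Drift_six_of_hW`**,
`sum_pairs_secondMoment_TbalOf_JsBalAn1_eq_trace_of_hW`, **`d1Drift_of_five_and_traceDrift_of_hW`**, `d1Drift_six_iff_five_and_traceDrift_of_hW`; §2 the (III′) literal
`JsB12CombShSym hLc N tabs cΛ cB` (`Odd Lc`, every table record): `tendsto_cesaro_longitudinal_JsB12CombShSym_of_d1Drift_of_hW`, `tendsto_cesaro_trace_JsB12CombShSym_of_d1Drift_six_of_hW`,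
`sum_pairs_secondMoment_TbalOf_JsB12CombShSym_eq_trace_of_hW`, `d1Drift_JsB12CombShSym_of_five_and_traceDrift_of_hW`, `d1Drift_JsB12CombShSym_six_iff_five_and_traceDrift_of_hW`.

Provenance: cell pub-balaban-gaps, seat g1-p1 GEN 17 (prover-pub-balaban-gaps-g1-p1-g17-0), 2026-08-25; imports this seat's `Gaps/D1WardTraceForm` (p402435 ✓) + GEN 14's
`Gaps/D1ReynoldsMeanDrift` + GEN 4's `Gaps/D1WordwiseDrift` + road BF-x's `Beta/D1BFx/RoadEnd`; no existing file touched.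
-/

noncomputable section

open Filter Topology
open Literature.MathematicalPhysics.QuantumFieldTheory Balaban1983to89 Balaban1983to89.Beta
open OneStepResolventKernel (JetData)
open OneStepKernelFamily (TbalOf flipK D1Drift secondMoment_flipK)
open PolarizationSign (WardTransversal)
open Drift (OneLoopDrift)
open AffineAveraging (box)
open Summit.QuantumFields.BalabanUV.Beta.MixedJetTablesPlug (JsBalAn1)
open Summit.QuantumFields.BalabanUV.Beta.CombChartJointEnd (JsB12CombShSym)
open Summit.QuantumFields.BalabanUV.Beta.SymmetrisedStepJets (SymTables)
open Summit.QuantumFields.BalabanUV.Beta.D1BFx.PermCovariantReynolds (reynoldsMean)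
open Summit.QuantumFields.BalabanUV.Beta.D1BFx.RoadEnd (tendsto_cesaro_of_oneLoopDrift)
open Summit.QuantumFields.BalabanUV.Gaps.D1WordwiseDrift (oneLoopDrift_sub oneLoopDrift_sum)
open Summit.QuantumFields.BalabanUV.Gaps.D1ReynoldsMeanPairs (six_mul_secondMoment_reynoldsMean_JsBalAn1 six_mul_secondMoment_reynoldsMean_JsB12CombShSym)
open Summit.QuantumFields.BalabanUV.Gaps.D1ReynoldsMeanDrift (sum_ite_lt_eq_sum_offDiagPairsLT d1Drift_six_to_reynoldsMean_JsBalAn1 d1Drift_six_to_reynoldsMean_JsB12CombShSym)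
open Summit.QuantumFields.BalabanUV.Gaps.D1WardLongitudinalForm (secondMoment_TbalOf_JsBalAn1_eq_neg_half_of_hW secondMoment_TbalOf_JsB12CombShSym_eq_neg_half_of_hW)
open Summit.QuantumFields.BalabanUV.Gaps.D1WardTraceForm (twelve_mul_secondMoment_reynoldsMean_JsBalAn1_eq_trace_of_hW twelve_mul_secondMoment_reynoldsMean_JsB12CombShSym_eq_trace_of_hW)

namespace Summit.QuantumFields.BalabanUV.Gaps.D1WardDriftTests

/-! ## §0 Drift calculus addenda (abstract sequences) -/

section Calculus

/-- [folklore] A CONSTANT MULTIPLE of a drifting sequence drifts: slope `c·b`, defect `|c|·A`. -/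
theorem oneLoopDrift_const_mul {b A : ℝ} {f : ℕ → ℝ} (c : ℝ) (hf : OneLoopDrift b A f) : OneLoopDrift (c * b) (|c| * A) (fun j => c * f j) := by
  intro k
  have e : ∑ j ∈ Finset.range k, c * f j - c * b * k = c * (∑ j ∈ Finset.range k, f j - b * k) := by
    rw [← Finset.mul_sum]; ring
  rw [e, abs_mul]
  exact mul_le_mul_of_nonneg_left (hf k) (abs_nonneg c)

/-- [folklore] Drift laws transport along a pointwise equality of sequences and an equality of slopes. -/
theorem oneLoopDrift_congr {b b' A : ℝ} {f g : ℕ → ℝ} (hf : OneLoopDrift b A f) (hfg : ∀ j, f j = g j) (hb : b = b') : OneLoopDrift b' A g := by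
  obtain rfl : f = g := funext hfg
  subst hb
  exact hf

/-- [folklore] **A FINITE LIST OF DRIFT LAWS (defects existentially bound) IS A DRIFT LAW**: slopes add. -/
theorem exists_oneLoopDrift_sum {ι : Type*} (s : Finset ι) {c : ι → ℝ} {f : ι → ℕ → ℝ} (h : ∀ w ∈ s, ∃ A : ℝ, OneLoopDrift (c w) A (f w)) :
    ∃ A : ℝ, OneLoopDrift (∑ w ∈ s, c w) A (fun j => ∑ w ∈ s, f w j) := by
  classical
  choose A hA using h
  exact ⟨_, oneLoopDrift_sum s (A := fun w => if hw : w ∈ s then A w hw else 0) fun w hw => by simpa only [dif_pos hw] using hA w hw⟩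

end Calculus

/-! ## §1 The β-lead's family `JsBalAn1(r; c⃗; cE₂; cB; T)` — no pin, no limit object -/

section Pinned

variable {Lc : ℕ} [NeZero Lc] {r : Fin (3 + 1) → ℕ}

/-- [folklore] **PIN-FREE NECESSARY TEST OF (D1) ON ONE DIAGONAL CHANNEL**: under `∀ j, hW_j`, for `μ ≠ ν`, `D1Drift Lc (JsBalAn1 …) N μ ν` forces the Cesàro means of the diagonal longitudinal
moments to converge: `(1∕m) Σ_{j<m} Σ_z T_j(ν,ν,z) z_μ² → −2·stepBal N Lc` (any `cE₂`; no rate certificate). -/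
theorem tendsto_cesaro_longitudinal_of_d1Drift_of_hW (hLc : 1 ≤ Lc) (hr : r ∈ box (3 + 1) Lc) (cE cVH cΛ cE₂ cB : ℝ) (T : Fin 4 → Fin 4 → Fin 4 → Fin 4 → ℝ) {μ ν : Fin 4} (hμν : μ ≠ ν)
    (N : ℝ) (hW : ∀ j : ℕ, WardTransversal (flipK (TbalOf Lc (JsBalAn1 hLc hr cE cVH cΛ cE₂ cB T) j))) (hD : D1Drift Lc (JsBalAn1 hLc hr cE cVH cΛ cE₂ cB T) N μ ν) :
    Tendsto (fun m : ℕ => (∑ j ∈ Finset.range m, ∑' z, TbalOf Lc (JsBalAn1 hLc hr cE cVH cΛ cE₂ cB T) j ν ν z * (z μ : ℝ) ^ 2) / (m : ℝ)) atTop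
      (𝓝 (-2 * B12Normalization.stepBal N Lc)) := by
  obtain ⟨A, hA⟩ := hD
  refine tendsto_cesaro_of_oneLoopDrift (oneLoopDrift_congr (oneLoopDrift_const_mul (-2) hA) (fun j => ?_) rfl)
  rw [secondMoment_TbalOf_JsBalAn1_eq_neg_half_of_hW hLc hr cE cVH cΛ cE₂ cB T j (hW j) hμν]
  ring

/-- [folklore] **PIN-FREE NECESSARY TEST OF (D1) AT THE SIX CHANNELS ON THE TRACE SCALAR**: under `∀ j, hW_j`, `(∀ a < b, D1Drift … N a b)` forces
`(1∕m) Σ_{j<m} Σ_ν Σ_z T_j(ν,ν,z)|z|² → −24·stepBal N Lc` — an axis-order-blind by-value test. -/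
theorem tendsto_cesaro_trace_of_d1Drift_six_of_hW (hLc : 1 ≤ Lc) (hr : r ∈ box (3 + 1) Lc) (cE cVH cΛ cE₂ cB : ℝ) (T : Fin 4 → Fin 4 → Fin 4 → Fin 4 → ℝ) (N : ℝ)
    (h : ∀ p ∈ (Finset.univ.filter fun p : Fin 4 × Fin 4 => p.1 < p.2), D1Drift Lc (JsBalAn1 hLc hr cE cVH cΛ cE₂ cB T) N p.1 p.2)
    (hW : ∀ j : ℕ, WardTransversal (flipK (TbalOf Lc (JsBalAn1 hLc hr cE cVH cΛ cE₂ cB T) j))) :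
    Tendsto (fun m : ℕ => (∑ j ∈ Finset.range m, ∑ ν, ∑' z, TbalOf Lc (JsBalAn1 hLc hr cE cVH cΛ cE₂ cB T) j ν ν z * ∑ μ, (z μ : ℝ) ^ 2) / (m : ℝ)) atTop
      (𝓝 (-24 * B12Normalization.stepBal N Lc)) := by
  have h01 : (0 : Fin 4) ≠ 1 := by decide
  obtain ⟨A, hA⟩ := d1Drift_six_to_reynoldsMean_JsBalAn1 hLc hr cE cVH cΛ cE₂ cB T N h h01
  refine tendsto_cesaro_of_oneLoopDrift (oneLoopDrift_congr (oneLoopDrift_const_mul (-24) hA) (fun j => ?_) rfl)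
  have h12 := twelve_mul_secondMoment_reynoldsMean_JsBalAn1_eq_trace_of_hW hLc hr cE cVH cΛ cE₂ cB T j (hW j) h01
  linarith

/-- [folklore] **THE CHANNEL BUDGET AT ONE LEVEL, UNDER hW_j ALONE**: `Σ_{a<b} β⁰_j(a,b) = −¼ Σ_ν Σ_z T_j(ν,ν,z)|z|²` (GEN 14's six-pair sum + row 88's trace form; no (1.21)). -/
theorem sum_pairs_secondMoment_TbalOf_JsBalAn1_eq_trace_of_hW (hLc : 1 ≤ Lc) (hr : r ∈ box (3 + 1) Lc) (cE cVH cΛ cE₂ cB : ℝ) (T : Fin 4 → Fin 4 → Fin 4 → Fin 4 → ℝ) (j : ℕ)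
    (hW : WardTransversal (flipK (TbalOf Lc (JsBalAn1 hLc hr cE cVH cΛ cE₂ cB T) j))) :
    ∑ p ∈ (Finset.univ.filter fun p : Fin 4 × Fin 4 => p.1 < p.2), B12Beta.secondMoment (TbalOf Lc (JsBalAn1 hLc hr cE cVH cΛ cE₂ cB T) j) p.1 p.2 =
      -(1 / 4) * ∑ ν, ∑' z, TbalOf Lc (JsBalAn1 hLc hr cE cVH cΛ cE₂ cB T) j ν ν z * ∑ μ, (z μ : ℝ) ^ 2 := by
  have h01 : (0 : Fin 4) ≠ 1 := by decide
  have h6 := six_mul_secondMoment_reynoldsMean_JsBalAn1 hLc hr cE cVH cΛ cE₂ cB T j h01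
  have h12 := twelve_mul_secondMoment_reynoldsMean_JsBalAn1_eq_trace_of_hW hLc hr cE cVH cΛ cE₂ cB T j hW h01
  simp only [secondMoment_flipK] at h6
  rw [sum_ite_lt_eq_sum_offDiagPairsLT] at h6
  linarith

/-- [folklore] **THE TRACE DRIFT LAW REPLACES ANY ONE CHANNEL**: under `∀ j, hW_j`, for `μ < ν`, (D1) at the FIVE channels other than `(μ,ν)` together with the trace drift law
`∃ A, OneLoopDrift (stepBal N Lc) A (j ↦ −(1∕24) Σ_ν Σ_z T_j(ν,ν,z)|z|²)` give `D1Drift Lc (JsBalAn1 …) N μ ν` (slope `6·stepBal − 5·stepBal`; the level budget above). -/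
theorem d1Drift_of_five_and_traceDrift_of_hW (hLc : 1 ≤ Lc) (hr : r ∈ box (3 + 1) Lc) (cE cVH cΛ cE₂ cB : ℝ) (T : Fin 4 → Fin 4 → Fin 4 → Fin 4 → ℝ) (N : ℝ) {μ ν : Fin 4} (hμν : μ < ν)
    (hW : ∀ j : ℕ, WardTransversal (flipK (TbalOf Lc (JsBalAn1 hLc hr cE cVH cΛ cE₂ cB T) j)))
    (h5 : ∀ p ∈ ((Finset.univ.filter fun p : Fin 4 × Fin 4 => p.1 < p.2).erase (μ, ν)), D1Drift Lc (JsBalAn1 hLc hr cE cVH cΛ cE₂ cB T) N p.1 p.2)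
    (htr : ∃ A : ℝ, OneLoopDrift (B12Normalization.stepBal N Lc) A
      (fun j => -(1 / 24) * ∑ ν, ∑' z, TbalOf Lc (JsBalAn1 hLc hr cE cVH cΛ cE₂ cB T) j ν ν z * ∑ μ, (z μ : ℝ) ^ 2)) :
    D1Drift Lc (JsBalAn1 hLc hr cE cVH cΛ cE₂ cB T) N μ ν := by
  have hp : (μ, ν) ∈ (Finset.univ.filter fun p : Fin 4 × Fin 4 => p.1 < p.2) := Finset.mem_filter.mpr ⟨Finset.mem_univ _, hμν⟩
  obtain ⟨A5, hA5⟩ := exists_oneLoopDrift_sum ((Finset.univ.filter fun p : Fin 4 × Fin 4 => p.1 < p.2).erase (μ, ν)) (c := fun _ => B12Normalization.stepBal N Lc)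
    (f := fun p j => B12Beta.secondMoment (TbalOf Lc (JsBalAn1 hLc hr cE cVH cΛ cE₂ cB T) j) p.1 p.2) h5
  obtain ⟨At, hAt⟩ := htr
  have hsub := oneLoopDrift_sub (oneLoopDrift_const_mul 6 hAt) hA5
  refine ⟨_, oneLoopDrift_congr hsub (fun j => ?_) ?_⟩
  · have hid := sum_pairs_secondMoment_TbalOf_JsBalAn1_eq_trace_of_hW hLc hr cE cVH cΛ cE₂ cB T j (hW j)
    have her := Finset.add_sum_erase (Finset.univ.filter fun p : Fin 4 × Fin 4 => p.1 < p.2)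
      (fun p => B12Beta.secondMoment (TbalOf Lc (JsBalAn1 hLc hr cE cVH cΛ cE₂ cB T) j) p.1 p.2) hp
    beta_reduce at her
    linarith
  · rw [Finset.sum_const, nsmul_eq_mul, Finset.card_erase_of_mem hp, show (Finset.univ.filter fun p : Fin 4 × Fin 4 => p.1 < p.2).card = 6 from by decide]
    norm_num
    ring

/-- [folklore] **UNDER THE WARD BINDER, «(D1) AT SIX CHANNELS» ⟺ «(D1) AT FIVE CHANNELS ∧ THE TRACE DRIFT LAW»** (any `μ < ν` singled out; any `cE₂`; no (1.21)). -/
theorem d1Drift_six_iff_five_and_traceDrift_of_hW (hLc : 1 ≤ Lc) (hr : r ∈ box (3 + 1) Lc) (cE cVH cΛ cE₂ cB : ℝ) (T : Fin 4 → Fin 4 → Fin 4 → Fin 4 → ℝ) (N : ℝ) {μ ν : Fin 4} (hμν : μ < ν)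
    (hW : ∀ j : ℕ, WardTransversal (flipK (TbalOf Lc (JsBalAn1 hLc hr cE cVH cΛ cE₂ cB T) j))) :
    (∀ p ∈ (Finset.univ.filter fun p : Fin 4 × Fin 4 => p.1 < p.2), D1Drift Lc (JsBalAn1 hLc hr cE cVH cΛ cE₂ cB T) N p.1 p.2) ↔
      (∀ p ∈ ((Finset.univ.filter fun p : Fin 4 × Fin 4 => p.1 < p.2).erase (μ, ν)), D1Drift Lc (JsBalAn1 hLc hr cE cVH cΛ cE₂ cB T) N p.1 p.2) ∧
        ∃ A : ℝ, OneLoopDrift (B12Normalization.stepBal N Lc) A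
          (fun j => -(1 / 24) * ∑ ν, ∑' z, TbalOf Lc (JsBalAn1 hLc hr cE cVH cΛ cE₂ cB T) j ν ν z * ∑ μ, (z μ : ℝ) ^ 2) := by
  refine ⟨fun h => ⟨fun p hp => h p (Finset.mem_of_mem_erase hp), ?_⟩, fun ⟨h5, htr⟩ p hp => ?_⟩
  · -- (D1) at the six channels ⟹ the trace drift law: GEN 14's Reynolds-mean drift read through row 88's trace form (row 89, re-derived here)
    have h01 : (0 : Fin 4) ≠ 1 := by decide
    obtain ⟨A, hA⟩ := d1Drift_six_to_reynoldsMean_JsBalAn1 hLc hr cE cVH cΛ cE₂ cB T N h h01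
    refine ⟨A, oneLoopDrift_congr hA (fun j => ?_) rfl⟩
    have h12 := twelve_mul_secondMoment_reynoldsMean_JsBalAn1_eq_trace_of_hW hLc hr cE cVH cΛ cE₂ cB T j (hW j) h01
    linarith
  by_cases hpe : p = (μ, ν)
  · rw [hpe]
    exact d1Drift_of_five_and_traceDrift_of_hW hLc hr cE cVH cΛ cE₂ cB T N hμν hW h5 htr
  · exact h5 p (Finset.mem_erase.mpr ⟨hpe, hp⟩)

end Pinned

/-! ## §2 The b2b wall's (III′) literal over every table record -/

section Record

variable {Lc : ℕ} [NeZero Lc]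

/-- [folklore] **PIN-FREE NECESSARY TEST OF (D1) FOR THE (III′) LITERAL ON ONE DIAGONAL CHANNEL**: `(1∕m) Σ_{j<m} Σ_z T_j(ν,ν,z) z_μ² → −2·stepBal Nc Lc`. -/
theorem tendsto_cesaro_longitudinal_JsB12CombShSym_of_d1Drift_of_hW (hLc : Odd Lc) (N : ℕ) (tabs : SymTables 3 Lc) (cΛ cB : ℝ) {μ ν : Fin 4} (hμν : μ ≠ ν) (Nc : ℝ)
    (hW : ∀ j : ℕ, WardTransversal (flipK (TbalOf Lc (JsB12CombShSym hLc N tabs cΛ cB) j))) (hD : D1Drift Lc (JsB12CombShSym hLc N tabs cΛ cB) Nc μ ν) :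
    Tendsto (fun m : ℕ => (∑ j ∈ Finset.range m, ∑' z, TbalOf Lc (JsB12CombShSym hLc N tabs cΛ cB) j ν ν z * (z μ : ℝ) ^ 2) / (m : ℝ)) atTop
      (𝓝 (-2 * B12Normalization.stepBal Nc Lc)) := by
  obtain ⟨A, hA⟩ := hD
  refine tendsto_cesaro_of_oneLoopDrift (oneLoopDrift_congr (oneLoopDrift_const_mul (-2) hA) (fun j => ?_) rfl)
  rw [secondMoment_TbalOf_JsB12CombShSym_eq_neg_half_of_hW hLc N tabs cΛ cB j (hW j) hμν]
  ring

/-- [folklore] **PIN-FREE NECESSARY TEST OF (D1) AT THE SIX CHANNELS OF THE (III′) LITERAL ON THE TRACE SCALAR**: `(1∕m) Σ_{j<m} Σ_ν Σ_z T_j(ν,ν,z)|z|² → −24·stepBal Nc Lc`. -/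
theorem tendsto_cesaro_trace_JsB12CombShSym_of_d1Drift_six_of_hW (hLc : Odd Lc) (N : ℕ) (tabs : SymTables 3 Lc) (cΛ cB : ℝ) (Nc : ℝ)
    (h : ∀ p ∈ (Finset.univ.filter fun p : Fin 4 × Fin 4 => p.1 < p.2), D1Drift Lc (JsB12CombShSym hLc N tabs cΛ cB) Nc p.1 p.2)
    (hW : ∀ j : ℕ, WardTransversal (flipK (TbalOf Lc (JsB12CombShSym hLc N tabs cΛ cB) j))) :
    Tendsto (fun m : ℕ => (∑ j ∈ Finset.range m, ∑ ν, ∑' z, TbalOf Lc (JsB12CombShSym hLc N tabs cΛ cB) j ν ν z * ∑ μ, (z μ : ℝ) ^ 2) / (m : ℝ)) atTop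
      (𝓝 (-24 * B12Normalization.stepBal Nc Lc)) := by
  have h01 : (0 : Fin 4) ≠ 1 := by decide
  obtain ⟨A, hA⟩ := d1Drift_six_to_reynoldsMean_JsB12CombShSym hLc N tabs cΛ cB Nc h h01
  refine tendsto_cesaro_of_oneLoopDrift (oneLoopDrift_congr (oneLoopDrift_const_mul (-24) hA) (fun j => ?_) rfl)
  have h12 := twelve_mul_secondMoment_reynoldsMean_JsB12CombShSym_eq_trace_of_hW hLc N tabs cΛ cB j (hW j) h01
  linarith

/-- [folklore] **THE CHANNEL BUDGET AT ONE LEVEL FOR THE (III′) LITERAL, UNDER hW_j ALONE**: `Σ_{a<b} β⁰_j(a,b) = −¼ Σ_ν Σ_z T_j(ν,ν,z)|z|²`. -/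
theorem sum_pairs_secondMoment_TbalOf_JsB12CombShSym_eq_trace_of_hW (hLc : Odd Lc) (N : ℕ) (tabs : SymTables 3 Lc) (cΛ cB : ℝ) (j : ℕ)
    (hW : WardTransversal (flipK (TbalOf Lc (JsB12CombShSym hLc N tabs cΛ cB) j))) :
    ∑ p ∈ (Finset.univ.filter fun p : Fin 4 × Fin 4 => p.1 < p.2), B12Beta.secondMoment (TbalOf Lc (JsB12CombShSym hLc N tabs cΛ cB) j) p.1 p.2 =
      -(1 / 4) * ∑ ν, ∑' z, TbalOf Lc (JsB12CombShSym hLc N tabs cΛ cB) j ν ν z * ∑ μ, (z μ : ℝ) ^ 2 := by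
  have h01 : (0 : Fin 4) ≠ 1 := by decide
  have h6 := six_mul_secondMoment_reynoldsMean_JsB12CombShSym hLc N tabs cΛ cB j h01
  have h12 := twelve_mul_secondMoment_reynoldsMean_JsB12CombShSym_eq_trace_of_hW hLc N tabs cΛ cB j hW h01
  simp only [secondMoment_flipK] at h6
  rw [sum_ite_lt_eq_sum_offDiagPairsLT] at h6
  linarith

/-- [folklore] **THE TRACE DRIFT LAW REPLACES ANY ONE CHANNEL, (III′) LITERAL** (`μ < ν`; every table record). -/
theorem d1Drift_JsB12CombShSym_of_five_and_traceDrift_of_hW (hLc : Odd Lc) (N : ℕ) (tabs : SymTables 3 Lc) (cΛ cB : ℝ) (Nc : ℝ) {μ ν : Fin 4} (hμν : μ < ν)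
    (hW : ∀ j : ℕ, WardTransversal (flipK (TbalOf Lc (JsB12CombShSym hLc N tabs cΛ cB) j)))
    (h5 : ∀ p ∈ ((Finset.univ.filter fun p : Fin 4 × Fin 4 => p.1 < p.2).erase (μ, ν)), D1Drift Lc (JsB12CombShSym hLc N tabs cΛ cB) Nc p.1 p.2)
    (htr : ∃ A : ℝ, OneLoopDrift (B12Normalization.stepBal Nc Lc) A
      (fun j => -(1 / 24) * ∑ ν, ∑' z, TbalOf Lc (JsB12CombShSym hLc N tabs cΛ cB) j ν ν z * ∑ μ, (z μ : ℝ) ^ 2)) :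
    D1Drift Lc (JsB12CombShSym hLc N tabs cΛ cB) Nc μ ν := by
  have hp : (μ, ν) ∈ (Finset.univ.filter fun p : Fin 4 × Fin 4 => p.1 < p.2) := Finset.mem_filter.mpr ⟨Finset.mem_univ _, hμν⟩
  obtain ⟨A5, hA5⟩ := exists_oneLoopDrift_sum ((Finset.univ.filter fun p : Fin 4 × Fin 4 => p.1 < p.2).erase (μ, ν)) (c := fun _ => B12Normalization.stepBal Nc Lc)
    (f := fun p j => B12Beta.secondMoment (TbalOf Lc (JsB12CombShSym hLc N tabs cΛ cB) j) p.1 p.2) h5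
  obtain ⟨At, hAt⟩ := htr
  have hsub := oneLoopDrift_sub (oneLoopDrift_const_mul 6 hAt) hA5
  refine ⟨_, oneLoopDrift_congr hsub (fun j => ?_) ?_⟩
  · have hid := sum_pairs_secondMoment_TbalOf_JsB12CombShSym_eq_trace_of_hW hLc N tabs cΛ cB j (hW j)
    have her := Finset.add_sum_erase (Finset.univ.filter fun p : Fin 4 × Fin 4 => p.1 < p.2)
      (fun p => B12Beta.secondMoment (TbalOf Lc (JsB12CombShSym hLc N tabs cΛ cB) j) p.1 p.2) hp
    beta_reduce at her
    linarith
  · rw [Finset.sum_const, nsmul_eq_mul, Finset.card_erase_of_mem hp, show (Finset.univ.filter fun p : Fin 4 × Fin 4 => p.1 < p.2).card = 6 from by decide]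
    norm_num
    ring

/-- [folklore] **UNDER THE WARD BINDER, «(D1) AT SIX CHANNELS» ⟺ «(D1) AT FIVE CHANNELS ∧ THE TRACE DRIFT LAW», (III′) LITERAL.** -/
theorem d1Drift_JsB12CombShSym_six_iff_five_and_traceDrift_of_hW (hLc : Odd Lc) (N : ℕ) (tabs : SymTables 3 Lc) (cΛ cB : ℝ) (Nc : ℝ) {μ ν : Fin 4} (hμν : μ < ν)
    (hW : ∀ j : ℕ, WardTransversal (flipK (TbalOf Lc (JsB12CombShSym hLc N tabs cΛ cB) j))) :
    (∀ p ∈ (Finset.univ.filter fun p : Fin 4 × Fin 4 => p.1 < p.2), D1Drift Lc (JsB12CombShSym hLc N tabs cΛ cB) Nc p.1 p.2) ↔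
      (∀ p ∈ ((Finset.univ.filter fun p : Fin 4 × Fin 4 => p.1 < p.2).erase (μ, ν)), D1Drift Lc (JsB12CombShSym hLc N tabs cΛ cB) Nc p.1 p.2) ∧
        ∃ A : ℝ, OneLoopDrift (B12Normalization.stepBal Nc Lc) A
          (fun j => -(1 / 24) * ∑ ν, ∑' z, TbalOf Lc (JsB12CombShSym hLc N tabs cΛ cB) j ν ν z * ∑ μ, (z μ : ℝ) ^ 2) := by
  refine ⟨fun h => ⟨fun p hp => h p (Finset.mem_of_mem_erase hp), ?_⟩, fun ⟨h5, htr⟩ p hp => ?_⟩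
  · have h01 : (0 : Fin 4) ≠ 1 := by decide
    obtain ⟨A, hA⟩ := d1Drift_six_to_reynoldsMean_JsB12CombShSym hLc N tabs cΛ cB Nc h h01
    refine ⟨A, oneLoopDrift_congr hA (fun j => ?_) rfl⟩
    have h12 := twelve_mul_secondMoment_reynoldsMean_JsB12CombShSym_eq_trace_of_hW hLc N tabs cΛ cB j (hW j) h01
    linarith
  by_cases hpe : p = (μ, ν)
  · rw [hpe]
    exact d1Drift_JsB12CombShSym_of_five_and_traceDrift_of_hW hLc N tabs cΛ cB Nc hμν hW h5 htr
  · exact h5 p (Finset.mem_erase.mpr ⟨hpe, hp⟩)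

end Record

end Summit.QuantumFields.BalabanUV.Gaps.D1WardDriftTests

end
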